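import Literature.AnabelianGeometry.AbsoluteAnabelian.AbsTopII.EllipticCuspidalizationContent
import Literature.AnabelianGeometry.AbsoluteAnabelian.AbsTopII.BelyiCuspidalizationContentSchemaScope
import HarnessLib

/-!
# [AbsTopII] Cor 3.3 (iii)(a), content conjunct (`EllipticCuspidalization.RealizesChain`): with NO cusp
# recorded on `X` the de-cuspidalization block is empty — the conjunct consumes the cusp of `X`

S. Mochizuki, *Topics in Absolute Anabelian Geometry II: Decomposition Groups and Endomorphisms*
[AbsTopII] (bib key `MochizukiAbsTopII2013`; manuscript pagination, lit key `paper:url-585b8d0ad0d9`):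
Example 3.2 pp. 66–67 ("`U := X ∖ E[N]`, `U ⇝ U_n ⇝ ⋯ ⇝ U_1 = D`, `n = N² − 1` de-cuspidalizations"),
Corollary 3.3 (iii)(a) p. 68 ("the natural surjection `Π_U ↠ Π_D` may be recovered from the chain of
•’s terminating at the third to last group"); [AbsTopI] (`MochizukiAbsTopI2012`) Def 4.2 (iii)
pp. 49–50 ((3_Π): "a cuspidal decomposition group in `Δⱼ`" = "any commensurator in `Δⱼ` of a
nontrivial image via `ρⱼ` of the inverse image in `Π̃` of the decomposition group in `Δ` of a cusp of
`X`"; (c): type •).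

PROOF-ONLY companion (no definition, no instance, no structure) of abc-iut-L4-t6's
`AbsTopII/EllipticCuspidalizationContent.lean` (p433376, the Cor 3.3 twin of the Cor 3.7 content
predicate; conjoined into abc-iut-L4-t4's `EllipticDatumModel.Cor_3_3_iii''`, p434762), cell abc-iut,
seat abc-iut-f-064 (F-f064-1 author; Cor 3.3 twin of the `Cor_3_7'` certificate
`BelyiCuspidalizationContentSchemaScope.lean` p434894, whose `ChainGroup.not_isDeCuspVia_of_isEmpty` is
reused BY NAME; offered 09:47Z as «offer (b)», abc-iut-f-067 — F-f067-1 author — released 10:00Z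
without taking it).  Complements abc-iut-L4-t6's `RealizesChain.projU_injective_of_sq_sub_one_eq_zero`
(`EllipticCuspidalizationContentProofs.lean` p434024: an EMPTY block, `N² − 1 = 0`, forces `Π_U ↠ Π_D`
injective) from the side of the cuspidal data:

* `EllipticCuspidalization.RealizesChain.sq_sub_one_eq_zero_of_isEmpty` — with NO cusp recorded on `X`
  (empty cuspidal data on `Π`) a realized chain has an EMPTY de-cuspidalization block, `N² − 1 = 0`:
  by (3_Π) every • step kills a cuspidal decomposition group coming from a cusp OF `X`;
* `EllipticCuspidalization.RealizesChain.projU_injective_of_isEmpty` — and then `Π_U ↠ Π_D`, read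
  through `Π_s ≅ Π_U`, `Π_t ≅ Π_D`, is a composite of isomorphisms, injective;
* `EllipticCuspidalization.not_realizesChain_of_isEmpty_of_two_le` — hence for `N ≥ 2` (a genuine
  `N`-torsion cuspidalization, `N² − 1 ≥ 3` points removed) NO output realizes a chain relative to empty
  cuspidal data: the content conjunct of Cor 3.3 (iii)(a) CONSUMES the cusp of `X` (the origin of the
  once-punctured elliptic curve, whose decomposition group the `[N]`-covering spreads over `E[N]`).

READING (honest framing): statements about OUR typed interface (a predicate on an output structure over
an abstract extension, relative to cuspidal data); a once-punctured elliptic curve HAS its cusp, so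
nothing in print is touched; typed ≠ proved; no side taken on [IUTchIII] Cor 3.12.
-/

open CategoryTheory Topology
open scoped Pointwise

universe u

namespace Literature.AnabelianGeometry.AbsoluteAnabelian.AbsTopII

open Literature.AlgebraicGeometry.Frobenioids (IsSlimGroup)
open FundamentalExtension

namespace EllipticCuspidalization

variable {E : FundamentalExtension.{u}} {K : EllipticCuspidalization E} {S : Set ℕ}
  {CD : CuspidalData E} {hP : IsSlimGroup E.arith} {hΔ : IsSlimGroup E.geom} {hne : E.geom ≠ ⊥}

/-- **With no cusp recorded on `X`, a realized chain has an EMPTY de-cuspidalization block**: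
`N² − 1 = 0`.  Every step `Πⱼ ⇝ Πⱼ₊₁` with `s ≤ j < t` is of type • ([AbsTopI] Def 4.2 (iii)(c)),
and with empty cuspidal data no such step exists (`ChainGroup.not_isDeCuspVia_of_isEmpty`).
[cite: MochizukiAbsTopII2013, Cor 3.3 (iii)(a) p.68] -/
theorem RealizesChain.sq_sub_one_eq_zero_of_isEmpty (h : K.RealizesChain S CD hP hΔ hne)
    (hC : IsEmpty CD.Cusp) : K.N ^ 2 - 1 = 0 := by
  obtain ⟨c, -, -, -, s, t, v, hst, htv, hv, -, -, -, -, -, -, ψ, -, -, -, -, htail, -⟩ := h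
  by_contra hk
  have hlt : s.val < t.val := by omega
  have hsl : s.val < c.len := by omega
  obtain ⟨φ, hφ, -⟩ := htail ⟨s.val, hsl⟩ le_rfl hlt
  exact ChainGroup.not_isDeCuspVia_of_isEmpty CD hC _ _ φ hφ

/-- **With no cusp recorded on `X`, a realized chain forces `Π_U ↠ Π_D` injective**: the block is empty
(`s = t`), the tracked composite `ψ_t` is `Π_U ⥲ Π_s`, and `Π_U ↠ Π_D`, read through `Π_t ⥲ Π_D ⊆ Π_C`,
is a composite of isomorphisms. [cite: MochizukiAbsTopII2013, Cor 3.3 (iii)(a) p.68] -/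
theorem RealizesChain.projU_injective_of_isEmpty (h : K.RealizesChain S CD hP hΔ hne)
    (hC : IsEmpty CD.Cusp) : Function.Injective K.projU.arith := by
  obtain ⟨c, -, -, -, s, t, v, hst, htv, hv, eU, eD, -, -, -, -, ψ, -, -, -, hψs, htail, hlast⟩ := h
  have hts : t.val = s.val := by
    by_contra hts
    have hlt : s.val < t.val := by omega
    have hsl : s.val < c.len := by omega
    obtain ⟨φ, hφ, -⟩ := htail ⟨s.val, hsl⟩ le_rfl hlt
    exact ChainGroup.not_isDeCuspVia_of_isEmpty CD hC _ _ φ hφ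
  obtain rfl : t = s := Fin.ext hts
  intro x y hxy
  have hx := hlast x
  have hy := hlast y
  rw [hψs] at hx hy
  rw [← hx, ← hy] at hxy
  exact eU.injective (eD.symm.injective (Subtype.val_injective hxy))

/-- **Hence for `N ≥ 2` NO output realizes a chain relative to empty cuspidal data**: the content
conjunct of Cor 3.3 (iii)(a) consumes the cusp of `X` (`N² − 1 ≥ 3` de-cuspidalizations are required,
none exists). [cite: MochizukiAbsTopII2013, Cor 3.3 (iii)(a) p.68] -/
theorem not_realizesChain_of_isEmpty_of_two_le (hC : IsEmpty CD.Cusp) (hN : 2 ≤ K.N) :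
    ¬ K.RealizesChain S CD hP hΔ hne := by
  intro h
  have h0 := h.sq_sub_one_eq_zero_of_isEmpty hC
  have : 4 ≤ K.N ^ 2 := by nlinarith
  omega

/-- Contrapositive: an output with `N ≥ 2` realizes a chain only if some cusp of `X` is recorded.
[cite: MochizukiAbsTopII2013, Cor 3.3 (iii)(a) p.68] -/
theorem RealizesChain.nonempty_cusp_of_two_le (h : K.RealizesChain S CD hP hΔ hne) (hN : 2 ≤ K.N) :
    Nonempty CD.Cusp := by
  rw [← not_isEmpty_iff]
  exact fun hC => not_realizesChain_of_isEmpty_of_two_le hC hN h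

end EllipticCuspidalization

end Literature.AnabelianGeometry.AbsoluteAnabelian.AbsTopII
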